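import Literature.AlgebraicGeometry.AbelianSchemes.AbelianSchemeKOfLEtaleOfInvertibleOrder
import Literature.AlgebraicGeometry.AbelianSchemes.AbelianSchemeFiniteSubgroupTorsion
import Literature.AlgebraicGeometry.AbelianSchemes.AbelianSchemeKOfLFibreRankEqCard
import Literature.AlgebraicGeometry.AbelianSchemes.AbelianSchemeKOfLBaseChange
import Literature.AlgebraicGeometry.AbelianSchemes.AbelianSchemeOverLevelBaseChange
import Literature.AlgebraicGeometry.AbelianSchemes.PolarizedAbelianSchemeWithLevelBaseChangeCancel
import HarnessLib

/-!
# On a shrunken affine stage `Spec R[1∕d]`, `K(L)` is killed by an exponent `n` INVERTIBLE on the stage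
# (Mumford, *Abelian Varieties* §13 «`K(L) ⊆ X[n]`», §6 Appl. 3; Deligne's theorem GW II Prop. 27.86; SGA 3 / EGA IV₄ 17.4.1)

Layer `Literature/AlgebraicGeometry/AbelianSchemes`, namespace `Literature.AlgebraicGeometry.AbelianSchemes.AbelianSchemeOver`.
THEOREMS ONLY (no definition, no named fact, no instance, no notation, no `sorry`).  Cell `hodgecm-mathlib` (D-0151), P6 «MOD programme»,
(s2-D) road (A), organ **«KL-STAGE»** (LEAD F0P6-plan (g2) RULING «M-28» (2) 2026-09-01T22:31:48Z, road (U-f) «UNIFORM FIBRE EXPONENT» «=»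
22:42:24Z; prover seat B-p02 (g22)): the DISCHARGE, after shrinking the stage, of the two hypotheses `hnR : IsUnit (n : R)` and
`hkill : ∀ T u, u ∈ K(L)(T) → u ^ n = 1` of ★ (K′) `exists_kOfL_etale_of_isUnit` (B-p04 (g39), p847009) — in EVERY characteristic of the
residue fields, for a base ring `R` Noetherian of characteristic `0` (`(d : R) ≠ 0` for `d ≥ 1`; no domain, no reducedness, NO generic
flatness and NO constancy of the fibre rank are used: flatness ∕ étaleness of `K(L)` on the shrunken stage then FOLLOW from ★ (K′)).

ROAD (U-f).  Let `i : Z ↪ A` represent `K(L)`, finite over `Spec R` (★ `exists_isClosedImmersion_isFinite_iff_memKOfL_of_isNoetherianRing`),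
with its unit∕law∕inverse factorisations (★ `exists_one_mul_inv_fac_of_memKOfL`).  `B := Γ(Z, 𝒪)` is a finite `R`-module (★
`moduleFinite_Γ_of_isFinite`) with, say, `r` generators; hence for EVERY field point `t : Spec K → Spec R` the fibre `Z_t ⊆ A_t` is a finite
subgroup scheme of ORDER `dim_K Γ(Z_t, 𝒪) = dim_K (K ⊗_R B) ≤ r` (★ U5 `finrank_tensor_eq_finrank_Γ_pullback`), killed by its order (DELIGNE, ★
U1 `FiniteSubgroupSubscheme.emb_pow_order`), so ÉTALE as soon as `r! ≠ 0` in `K` (★ U2 `etale_hom_of_pow_eq_one`; `o ∣ r!`).  Over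
`R₁ := R[1∕r!]` the base change `Z₁ := Z ×_R R₁ ↪ A₁` represents `K(L₁)` (§2, the FINITE twin of ★ `IsBaseChangeVia.exists_represents_memKOfL_pullback`),
its fibres are fibres of `Z` (§3) hence étale, so `Z₁ → Spec R₁` is FORMALLY UNRAMIFIED (★ `formallyUnramified_left_of_forall_exists_fieldPoint`)
and ★ (T3) `exists_pow_eq_one_of_formallyUnramified` yields `n ≥ 1` with `i₁ ^ n = 1`.  With `d := r!·n`: on every affine `Spec R' → Spec R`
with `d ∈ R'^×`, `n ∈ R'^×` and — factoring through `R₁` (Mathlib `IsLocalization.Away.lift`), cancelling base-change squares (★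
`isBaseChangeVia_of_comp`) and transferring the exponent (★ `IsBaseChangeVia.pow_eq_one_of_memKOfL_pullback`) — every point of `K(G^*L)` over
`R'` is `n`-torsion.

* §1 `finrank_baseChange_le_of_span_eq_top`, **`exists_forall_order_finiteSubgroupSubschemeFibre_le`** — a uniform bound `r` on the orders of
  all fibres `Z_t` of a finite closed subgroup subscheme;
* §2 **`IsBaseChangeVia.exists_represents_memKOfL_pullback_of_isFinite`** — `K(G^*L)` is represented by `Z ×_A A′ ↪ A′`, finite over `S′`,
  TOGETHER with the cartesian square `Z ×_A A′ → Z` over `S′ → S` (★ twin, `Etale` replaced by `IsFinite`);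
* §3 `etale_pullback_snd_of_isPullback` — étaleness of a fibre of `Z → S` along `t′ ≫ g` gives étaleness of the fibre of ANY base change
  `Z′ → S′` of it along `t′`; `natCast_ne_zero_of_dvd`, `isUnit_natCast_of_dvd` (divisors of units);
* §4 `formallyUnramified_hom_of_forall_fibre_etale` (the field-point criterion in `Over (Spec R)` dress), and the HEAD
  **`exists_nat_isUnit_pow_eq_one_of_memKOfL`**:
  `∃ d > 0, ∃ n > 0, n ∣ d ∧ ∀ R' (φ : R →+* R'), IsUnit (d : R') → ∀ A' G, A'.IsBaseChangeVia A (Spec.map φ) G → IsUnit (n : R') ∧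
   ∀ T u, A'.MemKOfL (G^*L) u → u ^ n = 1` — the letters `hnR`, `hkill` of ★ (K′) on every affine stage over `Spec R[1∕d]`.

HC_CM is proved only modulo the 2 remaining named inputs (hLiu418, h413); this file asserts nothing about HC and is count-neutral ★ capital.

## References
* [MumfordAV1970] D. Mumford, *Abelian Varieties* (1970), §13 (p. 123) («`K(L)` is finite», «`K(L) ⊆ X[n]`»), §6 Application 3 (p. 64).
* [GortzWedhorn2023] U. Görtz, T. Wedhorn, *Algebraic Geometry II* (2023), Prop. 27.86 (p. 633) (Deligne: a commutative finite group scheme is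
  killed by its order), Prop. 27.187 and Cor. 27.63 (torsion of abelian schemes étale where the exponent is invertible), (27.1.1).
* [GortzWedhorn2020] U. Görtz, T. Wedhorn, *Algebraic Geometry I*, 2nd ed. (2020), Prop. 4.16 (p. 101), Section (4.8) (fibres), Section (4.15)
  (p. 116) (base change).
* [EGAIV4] A. Grothendieck, J. Dieudonné, EGA IV₄, Publ. Math. IHÉS 32 (1967), Thm. 17.4.1, Cor. 17.4.2 (unramified ⇔ fibrewise unramified).
* [MumfordFogartyKirwan1994] D. Mumford, J. Fogarty, F. Kirwan, *GIT*, 3rd ed. (1994), Ch. 6 §2 Prop. 6.13 (iii) (p. 123), Ch. 7 §2 Def. 7.2 (p. 129).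
-/

set_option autoImplicit false

noncomputable section

-- `TopCat.Presheaf`/`Scheme.Modules` are not reducible (as in ★ `AbelianSchemeKOfL`).
set_option backward.isDefEq.respectTransparency false

open CategoryTheory CategoryTheory.Limits AlgebraicGeometry MonoidalCategory CartesianMonoidalCategory TensorProduct

open scoped MonObj

namespace Literature.AlgebraicGeometry.AbelianSchemes

open Literature.AlgebraicGeometry.Motives Literature.AlgebraicGeometry.Motives.AbelianVariety Literature.AlgebraicGeometry.Limits
  Literature.AlgebraicGeometry.AbelianVarieties Literature.AlgebraicGeometry.Modules Literature.AlgebraicGeometry.Morphisms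

namespace AbelianSchemeOver

/-! ## §1 A uniform bound on the orders of the fibres of a finite closed subgroup subscheme -/

section FibreBound

/-- **`dim_K (K ⊗_R B) ≤ r`** for an `R`-module `B` spanned by `r` elements and any field `K` over `R` (the base change is spanned by the
`r` elements `1 ⊗ bᵢ`). [cite: GortzWedhorn2020, Section (4.8)] -/
theorem finrank_baseChange_le_of_span_eq_top {R : Type} [CommRing R] {B : Type} [AddCommGroup B] [Module R B] {r : ℕ} (b : Fin r → B)
    (hb : Submodule.span R (Set.range b) = ⊤) (K : Type) [Field K] [Algebra R K] :
    Module.finrank K (K ⊗[R] B) ≤ r := by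
  have hspan : Submodule.span K (Set.range fun j : Fin r => (1 : K) ⊗ₜ[R] b j) = ⊤ := by
    have h := Submodule.baseChange_span (A := K) (R := R) (Set.range b)
    rw [hb, Submodule.baseChange_top] at h
    rw [h, ← Set.range_comp]
    rfl
  calc Module.finrank K (K ⊗[R] B)
      = Module.finrank K (Submodule.span K (Set.range fun j : Fin r => (1 : K) ⊗ₜ[R] b j)) := by
        rw [hspan, finrank_top]
    _ ≤ Fintype.card (Fin r) := finrank_range_le_card _
    _ = r := Fintype.card_fin r

variable {R : Type} [CommRing R] (A : AbelianSchemeOver (Spec (.of R)))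
  {Z : Over (Spec (.of R))} (i : Z ⟶ A.X) [IsClosedImmersion i.left] [IsFinite Z.hom]
  (he : ∃ e : 𝟙_ (Over (Spec (.of R))) ⟶ Z, e ≫ i = 1)
  (hm : ∃ m : Z ⊗ Z ⟶ Z, m ≫ i = (fst Z Z ≫ i) * (snd Z Z ≫ i))
  (hn : ∃ n : Z ⟶ Z, n ≫ i = i⁻¹)

/-- **A UNIFORM BOUND ON THE FIBRE ORDERS**: for a finite closed subgroup subscheme `Z ↪ A` over `Spec R` there is `r` with
`order (Z_t) ≤ r` for EVERY field point `t : Spec K → Spec R` — `order (Z_t) = dim_K Γ(Z_t, 𝒪) = dim_K (K ⊗_R Γ(Z, 𝒪))` (★ U5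
`finrank_tensor_eq_finrank_Γ_pullback`) and `Γ(Z, 𝒪)` is a finite `R`-module (★ `moduleFinite_Γ_of_isFinite`).
[cite: MumfordAV1970, §13 (p. 123)] [cite: GortzWedhorn2020, Prop. 4.16 (p. 101) and Section (4.8)] -/
theorem exists_forall_order_finiteSubgroupSubschemeFibre_le :
    ∃ r : ℕ, ∀ (K : Type) [Field K] (t : Spec (.of K) ⟶ Spec (.of R)), (A.finiteSubgroupSubschemeFibre i he hm hn t).order ≤ r := by
  letI : Algebra R Γ(Z.left, ⊤) := (Motives.algebraMapΓ Z.hom).hom.toAlgebra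
  haveI : Module.Finite R Γ(Z.left, ⊤) := moduleFinite_Γ_of_isFinite
  obtain ⟨r, b, hb⟩ := Module.Finite.exists_fin (R := R) (M := Γ(Z.left, ⊤))
  refine ⟨r, fun K _ t => ?_⟩
  -- write the field point as `Spec` of a ring map
  obtain ⟨φ, rfl⟩ : ∃ φ : R →+* K, t = Spec.map (CommRingCat.ofHom φ) :=
    ⟨(Spec.preimage t).hom, by rw [CommRingCat.ofHom_hom, Spec.map_preimage]⟩
  letI : Algebra R K := φ.toAlgebra
  have h1 := finrank_tensor_eq_finrank_Γ_pullback (Z := Z) K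
  have h2 := finrank_baseChange_le_of_span_eq_top b hb K
  -- `order (Z_t) = dim_K Γ(Z_t, 𝒪)` with the SAME algebra structure (`algebraMapΓ` of the projection to `Spec K`)
  letI algK : Algebra K Γ(pullback Z.hom (Spec.map (CommRingCat.ofHom (algebraMap R K))), ⊤) :=
    (Motives.algebraMapΓ (pullback.snd Z.hom (Spec.map (CommRingCat.ofHom (algebraMap R K))))).hom.toAlgebra
  have h3 : (A.finiteSubgroupSubschemeFibre i he hm hn (Spec.map (CommRingCat.ofHom φ))).order =
      Module.finrank K Γ(pullback Z.hom (Spec.map (CommRingCat.ofHom (algebraMap R K))), ⊤) := rfl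
  omega

end FibreBound

/-! ## §2 Base change of the representing subscheme of `K(L)`: the finite twin of ★ `exists_represents_memKOfL_pullback` -/

section Represents

universe u

variable {S S' : Scheme.{u}} {A' : AbelianSchemeOver S'} {A : AbelianSchemeOver S} {g : S' ⟶ S}
  {G : A'.X.left ⟶ A.X.left}

/-- **`K(G^*L)` is represented by `Z ×_A A′ ↪ A′`, FINITE over `S′`, with its cartesian square over `S′ → S`**: if `K(L)` is represented
by a closed immersion `i : Z ↪ A` with `Z → S` finite, then for every base-change square of group schemes `G : A′ → A` over `g : S′ → S`
(★ `IsBaseChangeVia`) the closed immersion `i′ : Z′ := Z ×_A A′ ↪ A′` has `Z′ → S′` finite, the projection `f_Z : Z′ → Z` makes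
`(f_Z, Z′ → S′; Z → S, g)` CARTESIAN and `f_Z ≫ i = i′ ≫ G`, and `i′` represents `K(G^*L)` (★ `memKOfL_pullback_iff`).  Verbatim ★
`exists_represents_memKOfL_pullback` with `Etale` replaced by `IsFinite` and the square exported.
[cite: MumfordAV1970, §13 (p. 123)] [cite: GortzWedhorn2020, Section (4.15) (p. 116)] -/
theorem IsBaseChangeVia.exists_represents_memKOfL_pullback_of_isFinite (h : A'.IsBaseChangeVia A g G) {L : A.left.Modules}
    (hL : HasRank L 1) {Z : Over S} (i : Z ⟶ A.X) [IsClosedImmersion i.left] [IsFinite Z.hom]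
    (hZ : ∀ (T : Over S) (u : T ⟶ A.X), (∃ v : T ⟶ Z, v ≫ i = u) ↔ A.MemKOfL L u) :
    ∃ (Z' : Over S') (i' : Z' ⟶ A'.X) (_ : IsClosedImmersion i'.left) (_ : IsFinite Z'.hom) (fZ : Z'.left ⟶ Z.left)
      (_ : IsPullback fZ Z'.hom Z.hom g), fZ ≫ i.left = i'.left ≫ G ∧
      ∀ (T' : Over S') (u' : T' ⟶ A'.X),
        (∃ v' : T' ⟶ Z', v' ≫ i' = u') ↔ A'.MemKOfL ((Scheme.Modules.pullback G).obj L) u' := by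
  let Z' : Over S' := Over.mk (pullback.snd i.left G ≫ A'.X.hom)
  let i' : Z' ⟶ A'.X := Over.homMk (pullback.snd i.left G) rfl
  haveI : IsClosedImmersion i'.left := by
    change IsClosedImmersion (pullback.snd i.left G); infer_instance
  let fZ : Z'.left ⟶ Z.left := pullback.fst i.left G
  have hcond : fZ ≫ i.left = i'.left ≫ G := pullback.condition
  have hsq : IsPullback fZ Z'.hom Z.hom g := by
    have h1 : IsPullback fZ i'.left i.left G := IsPullback.of_hasPullback i.left G
    have h2 : IsPullback G A'.X.hom A.X.hom g := h.snd.1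
    have h12 := h1.paste_vert h2
    rw [Over.w i] at h12
    exact h12
  haveI : IsFinite Z'.hom := MorphismProperty.IsStableUnderBaseChange.of_isPullback hsq inferInstance
  refine ⟨Z', i', inferInstance, inferInstance, fZ, hsq, hcond, fun T' u' => ?_⟩
  rw [h.memKOfL_pullback_iff hL, ← hZ]
  constructor
  · rintro ⟨v', hv'⟩
    have hvS : (v'.left ≫ fZ) ≫ Z.hom = (Over.mk (T'.hom ≫ g)).hom := by
      change (v'.left ≫ fZ) ≫ Z.hom = T'.hom ≫ g
      rw [Category.assoc, hsq.w, ← Category.assoc, Over.w v']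
    refine ⟨Over.homMk (v'.left ≫ fZ) hvS, Over.OverMorphism.ext ?_⟩
    change (v'.left ≫ fZ) ≫ i.left = u'.left ≫ G
    rw [Category.assoc, hcond, ← Category.assoc, ← Over.comp_left, hv']
  · rintro ⟨v, hv⟩
    have hvl : v.left ≫ i.left = u'.left ≫ G := congrArg (fun f : Over.mk (T'.hom ≫ g) ⟶ A.X => f.left) hv
    let v'L : T'.left ⟶ Z'.left := pullback.lift v.left u'.left hvl
    have hv'L : v'L ≫ i'.left = u'.left := pullback.lift_snd _ _ _
    have hvS : v'L ≫ Z'.hom = T'.hom := by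
      change v'L ≫ i'.left ≫ A'.X.hom = T'.hom
      rw [← Category.assoc, hv'L]; exact Over.w u'
    exact ⟨Over.homMk v'L hvS, Over.OverMorphism.ext hv'L⟩

/-! ## §3 Fibres of a base change are fibres; divisors of units -/

omit A' A G in
/-- **Étaleness of a fibre of `Z → S` along `t′ ≫ g` gives étaleness of the fibre of any base change `Z′ → S′` of it along `t′`**
(both are base changes of `Z → S` along `t′ ≫ g`; pasting ★ Mathlib `IsPullback.paste_vert` and the comparison isomorphism
`IsPullback.isoPullback`). [cite: GortzWedhorn2020, Prop. 4.16 (p. 101) and Section (4.8)] -/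
theorem etale_pullback_snd_of_isPullback {Z : Over S} {Z' : Over S'} {fZ : Z'.left ⟶ Z.left} (hsq : IsPullback fZ Z'.hom Z.hom g)
    {K : Type u} [Field K] (t' : Spec (.of K) ⟶ S') [Etale (pullback.snd Z.hom (t' ≫ g))] :
    Etale (pullback.snd Z'.hom t') := by
  have h1 : IsPullback (pullback.fst Z'.hom t') (pullback.snd Z'.hom t') Z'.hom t' := IsPullback.of_hasPullback Z'.hom t'
  have h12 : IsPullback (pullback.fst Z'.hom t' ≫ fZ) (pullback.snd Z'.hom t') Z.hom (t' ≫ g) := h1.paste_horiz hsq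
  have e : pullback.snd Z'.hom t' = h12.isoPullback.hom ≫ pullback.snd Z.hom (t' ≫ g) := (h12.isoPullback_hom_snd).symm
  rw [e]
  infer_instance

end Represents

/-- A natural number dividing a unit of a ring is non-zero in every field over it… in the cast form: `o ∣ d`, `(d : K) ≠ 0 ⇒ (o : K) ≠ 0`.
[folklore] [cite: GortzWedhorn2023, (27.1.1)] -/
theorem natCast_ne_zero_of_dvd {K : Type*} [CommRing K] {o d : ℕ} (hod : o ∣ d) (hd : (d : K) ≠ 0) : (o : K) ≠ 0 := by
  obtain ⟨c, rfl⟩ := hod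
  intro h
  apply hd
  rw [Nat.cast_mul, h, zero_mul]

/-- `n ∣ d` and `d` a unit ⇒ `n` a unit (cast form). [folklore] [cite: GortzWedhorn2023, (27.1.1)] -/
theorem isUnit_natCast_of_dvd {R' : Type*} [CommRing R'] {n d : ℕ} (hnd : n ∣ d) (hd : IsUnit ((d : ℕ) : R')) :
    IsUnit ((n : ℕ) : R') := by
  obtain ⟨c, rfl⟩ := hnd
  rw [Nat.cast_mul] at hd
  exact isUnit_of_mul_isUnit_left hd

/-! ## §4 Formal unramifiedness from étale fibres, and the HEAD -/

section Head

variable {R : Type} [CommRing R] (A : AbelianSchemeOver (Spec (.of R)))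

/-- **The field-point criterion in `Over (Spec R)` dress**: if every fibre `Z ×_R Spec κ(𝔭) → Spec κ(𝔭)` of `Z → Spec R` (a scheme of
finite type over `Spec R`) is ÉTALE, then `Z → Spec R` is FORMALLY UNRAMIFIED (★ `formallyUnramified_left_of_forall_exists_fieldPoint`,
EGA IV₄ 17.4.1; the pattern of ★ `formallyUnramified_hom_of_subgroup`). [cite: EGAIV4, Thm. 17.4.1 and Cor. 17.4.2]
[cite: GortzWedhorn2023, Prop. 27.86 (p. 633)] -/
theorem formallyUnramified_hom_of_forall_fibre_etale {Z : Over (Spec (.of R))} [LocallyOfFiniteType Z.hom]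
    (h : ∀ (K : Type) [Field K] (t : Spec (.of K) ⟶ Spec (.of R)), Etale (pullback.snd Z.hom t)) :
    FormallyUnramified Z.hom := by
  have hlft : LocallyOfFiniteType (toUnit Z).left := by rw [Over.toUnit_left]; infer_instance
  have key : FormallyUnramified (toUnit Z).left := by
    refine formallyUnramified_left_of_forall_exists_fieldPoint (toUnit Z) fun s => ?_
    refine ⟨s.asIdeal.ResidueField, inferInstance, Spec.map (CommRingCat.ofHom (algebraMap R s.asIdeal.ResidueField)), ?_, ?_⟩
    · haveI : Subsingleton ↥(Spec (CommRingCat.of s.asIdeal.ResidueField)) :=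
        inferInstanceAs (Subsingleton (PrimeSpectrum s.asIdeal.ResidueField))
      have h1 := Scheme.Spec.map_residueFieldIso_inv_eq_fromSpecResidueField (.of R) s
      have h2 : IsLocalRing.closedPoint s.asIdeal.ResidueField =
          Spec.map (Scheme.Spec.residueFieldIso (.of R) s).inv (IsLocalRing.closedPoint _) := Subsingleton.elim _ _
      rw [h2, ← Scheme.Hom.comp_apply, h1, Scheme.fromSpecResidueField_apply]
    · set t := Spec.map (CommRingCat.ofHom (algebraMap R s.asIdeal.ResidueField)) with ht
      haveI : Etale ((Over.pullback t).obj Z).hom := h _ t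
      haveI : FormallyUnramified (((Over.pullback t).map (toUnit Z)).left ≫ ((Over.pullback t).obj (𝟙_ _)).hom) := by
        rw [Over.w]
        exact (Etale.iff_flat_and_formallyUnramified.mp inferInstance).2.1
      exact FormallyUnramified.of_comp _ ((Over.pullback t).obj (𝟙_ (Over (Spec (.of R))))).hom
  rwa [Over.toUnit_left] at key

/-- **`K(L)` does not see the difference between isomorphic rank-one modules** (membership is a statement about the class
`[Λ(L)]`, ★ `memKOfL_iff_mumfordClass`, and `[det L] = [det L′]` for `L ≅ L′`, ★ `detClass_eq_of_iso`). [cite: MumfordAV1970, §13 (p. 123)] -/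
theorem memKOfL_iff_of_iso {S : Scheme} (B : AbelianSchemeOver S) {L L' : B.left.Modules} (e : L ≅ L') (hL : HasRank L 1)
    (hL' : HasRank L' 1) {T : Over S} (u : T ⟶ B.X) : B.MemKOfL L u ↔ B.MemKOfL L' u := by
  rw [B.memKOfL_iff_mumfordClass hL u, B.memKOfL_iff_mumfordClass hL' u,
    detClass_eq_of_iso e (HasRank.isFiniteLocallyFree' hL) (HasRank.isFiniteLocallyFree' hL')]

/-- **HEAD — organ «KL-STAGE»: ON A SHRUNKEN AFFINE STAGE, `K(L)` IS KILLED BY AN EXPONENT INVERTIBLE ON THE STAGE.**  For an abelian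
scheme `A` over a Noetherian ring `R` of characteristic `0`, a rank-one `L` on `A` rigidified along the unit section (`hε`) and fibrewise of the
class of an ample divisor (`hΘ`) — exactly the hypotheses of ★ (K′) `exists_kOfL_etale_of_isUnit` — there are integers `d ≥ 1` and `n ≥ 1`,
`n ∣ d`, such that on EVERY affine stage `Spec R' → Spec R` on which `d` is invertible and for EVERY base change `G : A′ → A` of group schemes
over it (★ `IsBaseChangeVia`): `n ∈ R'^×` (the letter `hnR`) and every `T`-valued point of `K(G^*L)` is `n`-torsion (the letter `hkill`).  Road
(U-f): uniform bound on the fibre orders (§1) ⇒ over `R[1∕r!]` all fibres of `K(L)` are étale (DELIGNE ★ `emb_pow_order` + ★ `etale_hom_of_pow_eq_one`,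
§3) ⇒ `K(L) → Spec R[1∕r!]` formally unramified ⇒ ★ (T3) an exponent `n` ⇒ `d := r!·n`, transfer along ★ `isBaseChangeVia_of_comp` ∕ ★
`pow_eq_one_of_memKOfL_pullback`.  NO generic flatness, NO rank constancy; with ★ (K′) it makes `K(L)` finite ÉTALE on the stage.
[cite: MumfordAV1970, §13 (p. 123) and §6 Application 3 (p. 64)] [cite: GortzWedhorn2023, Prop. 27.86 (p. 633), Prop. 27.187 and Cor. 27.63]
[cite: EGAIV4, Thm. 17.4.1 and Cor. 17.4.2] [cite: MumfordFogartyKirwan1994, Ch. 6 §2 Prop. 6.13 (iii) (p. 123)] -/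
theorem exists_nat_isUnit_pow_eq_one_of_memKOfL [IsNoetherianRing R] [CharZero R] {L : A.left.Modules} (hL : HasRank L 1)
    (hε : CechPic.pullback A.unitSection (detClass (HasRank.isFiniteLocallyFree' hL)) = 1)
    (hΘ : ∀ ⦃Ω : Type⦄ [Field Ω] [IsAlgClosed Ω] (s : Spec (.of Ω) ⟶ Spec (.of R)),
      ∃ Θ : CartierDivisor (A.fibre s).toAbelianVariety.X.left, Θ.IsAmple ∧
        CechPic.pullback (X := (A.fibre s).toAbelianVariety.X.left) (pullback.fst A.X.hom s)
          (detClass (HasRank.isFiniteLocallyFree' hL)) = Θ.cechClass) :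
    ∃ d : ℕ, 0 < d ∧ ∃ n : ℕ, 0 < n ∧ n ∣ d ∧
      ∀ (R' : Type) [CommRing R'] (φ : R →+* R'), IsUnit ((d : ℕ) : R') →
        ∀ (A' : AbelianSchemeOver (Spec (.of R'))) (G : A'.X.left ⟶ A.X.left),
          A'.IsBaseChangeVia A (Spec.map (CommRingCat.ofHom φ)) G →
            IsUnit ((n : ℕ) : R') ∧
              ∀ (T : Over (Spec (.of R'))) (u : T ⟶ A'.X),
                A'.MemKOfL ((Scheme.Modules.pullback G).obj L) u → u ^ n = 1 := by
  -- (a) `K(L)` is a finite closed subgroup subscheme `i : Z ↪ A`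
  obtain ⟨Z, i, hci, hfin, hZ⟩ := A.exists_isClosedImmersion_isFinite_iff_memKOfL_of_isNoetherianRing hL hε hΘ
  obtain ⟨he, hm, hn⟩ := A.exists_one_mul_inv_fac_of_memKOfL i hL hε hZ
  -- (b) a uniform bound on the fibre orders
  obtain ⟨r, hr⟩ := A.exists_forall_order_finiteSubgroupSubschemeFibre_le i he hm hn
  -- (c) the stage `R₁ = R[1∕r!]` and the base change of everything to it
  set d₀ : ℕ := r.factorial with hd₀
  let R₁ : Type := Localization.Away ((d₀ : ℕ) : R)
  let g₁ : Spec (.of R₁) ⟶ Spec (.of R) := Spec.map (CommRingCat.ofHom (algebraMap R R₁))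
  let A₁ : AbelianSchemeOver (Spec (.of R₁)) := A.baseChange g₁
  have h₁ : A₁.IsBaseChangeVia A g₁ (pullback.fst A.X.hom g₁) := A.baseChange_isBaseChangeVia g₁
  have hL₁ : HasRank ((Scheme.Modules.pullback (pullback.fst A.X.hom g₁)).obj L) 1 := hasRank_pullback _ hL
  have hε₁ := h₁.pullback_unitSection_detClass_pullback_eq_one hL hε
  obtain ⟨Z₁, i₁, hci₁, hfin₁, fZ, hsq, -, hZ₁⟩ := h₁.exists_represents_memKOfL_pullback_of_isFinite hL i hZ
  obtain ⟨he₁, hm₁, hn₁⟩ := A₁.exists_one_mul_inv_fac_of_memKOfL i₁ hL₁ hε₁ hZ₁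
  have hd₀R₁ : IsUnit ((d₀ : ℕ) : R₁) := by
    have hu := IsLocalization.Away.algebraMap_isUnit (S := R₁) ((d₀ : ℕ) : R)
    rwa [map_natCast] at hu
  -- (d) every fibre of `Z₁ → Spec R₁` is étale: it is the fibre of `Z` at a point where `r!` is invertible (Deligne + U2)
  have hfib : ∀ (K : Type) [Field K] (t₁ : Spec (.of K) ⟶ Spec (.of R₁)), Etale (pullback.snd Z₁.hom t₁) := by
    intro K _ t₁
    let D := A.finiteSubgroupSubschemeFibre i he hm hn (t₁ ≫ g₁)
    haveI : IsClosedImmersion D.emb.left := D.isClosedImmersion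
    have hfact : ((d₀ : ℕ) : K) ≠ 0 := natCast_ne_zero_of_isUnit_specMap t₁ hd₀R₁
    have hordK : ((D.order : ℤ) : K) ≠ 0 := by
      rw [Int.cast_natCast]
      exact natCast_ne_zero_of_dvd (Nat.dvd_factorial D.order_pos (hr K (t₁ ≫ g₁))) hfact
    have hpow : D.emb ^ (D.order : ℤ) = 1 := by rw [zpow_natCast]; exact D.emb_pow_order
    haveI : Etale (pullback.snd Z.hom (t₁ ≫ g₁)) := etale_hom_of_pow_eq_one D.emb (D.order : ℤ) hordK hpow
    exact etale_pullback_snd_of_isPullback hsq t₁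
  -- (e) `Z₁ → Spec R₁` is formally unramified, hence killed by an exponent `n ≥ 1` (★ (T3))
  haveI : LocallyOfFiniteType Z₁.hom := inferInstance
  haveI : FormallyUnramified Z₁.hom := formallyUnramified_hom_of_forall_fibre_etale hfib
  obtain ⟨n, hn0, hin⟩ := A₁.exists_pow_eq_one_of_formallyUnramified i₁ he₁ hm₁ hn₁
  -- (f) the output: `d := r!·n`
  refine ⟨d₀ * n, Nat.mul_pos (Nat.factorial_pos r) hn0, n, hn0, Dvd.intro_left d₀ rfl, fun R' _ φ hd A' G hA' => ?_⟩
  have hnR' : IsUnit ((n : ℕ) : R') := isUnit_natCast_of_dvd (Dvd.intro_left d₀ rfl) hd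
  have hd₀R' : IsUnit ((d₀ : ℕ) : R') := isUnit_natCast_of_dvd (Dvd.intro n rfl) hd
  refine ⟨hnR', fun T u hu => ?_⟩
  -- factor `φ` through `R₁ = R[1∕r!]`
  have hφd₀ : IsUnit (φ ((d₀ : ℕ) : R)) := by rwa [map_natCast]
  let φ₁ : R₁ →+* R' := IsLocalization.Away.lift ((d₀ : ℕ) : R) hφd₀
  have hφ₁ : φ₁.comp (algebraMap R R₁) = φ := IsLocalization.Away.lift_comp ((d₀ : ℕ) : R) hφd₀
  let t : Spec (.of R') ⟶ Spec (.of R₁) := Spec.map (CommRingCat.ofHom φ₁)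
  have hg : Spec.map (CommRingCat.ofHom φ) = t ≫ g₁ := by
    change _ = Spec.map (CommRingCat.ofHom φ₁) ≫ Spec.map (CommRingCat.ofHom (algebraMap R R₁))
    rw [← Spec.map_comp, ← CommRingCat.ofHom_comp, hφ₁]
  rw [hg] at hA'
  -- cancel the base-change squares: `A′` is a base change of `A₁` along `t`
  obtain ⟨m, hmG, hmπ⟩ := IsBaseChangeVia.exists_comp_eq_of_comp hA' h₁
  have h' : A'.IsBaseChangeVia A₁ t m := isBaseChangeVia_of_comp hA' h₁ m hmG hmπ
  -- `G^*L ≅ m^*(G₁^*L)`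
  let e : (Scheme.Modules.pullback G).obj L ≅
      (Scheme.Modules.pullback m).obj ((Scheme.Modules.pullback (pullback.fst A.X.hom g₁)).obj L) :=
    ((Scheme.Modules.pullbackComp m (pullback.fst A.X.hom g₁)).app L ≪≫ (Scheme.Modules.pullbackCongr hmG).app L).symm
  have hu' : A'.MemKOfL ((Scheme.Modules.pullback m).obj ((Scheme.Modules.pullback (pullback.fst A.X.hom g₁)).obj L)) u :=
    (A'.memKOfL_iff_of_iso e (hasRank_pullback _ hL) (hasRank_pullback _ hL₁) u).1 hu
  -- transfer the exponent
  exact h'.pow_eq_one_of_memKOfL_pullback hL₁ i₁ hZ₁ hin u hu'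

end Head

end AbelianSchemeOver

end Literature.AlgebraicGeometry.AbelianSchemes

end
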